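import Summits.QuantumFields.BalabanUV.T4Continuum.Support.NE7FlatAverageBridge
import Summits.QuantumFields.BalabanUV.T4Continuum.Support.NE3SmoothRightInverseFlat
import HarnessLib

/-!
# NE7FlatHkRightInverse — BRICK 2 OF THE BRIDGE: ANY lift exact for the straight `M`-block average becomes an EXACT right inverse of the T4
# linearised `(j+1)`-fold average at the flat background after row NE3's curl-free corrector, and lit-balaban's Landau minimiser `H_k`
# ([Balaban1984PropagatorsI] (1.63), `B5Hk163Torus.HkOp`), pulled back entrywise to ℤ^d, IS such a lift: `cpushIter L j 1 (R_H B) = L^{j+1}·(B ∘ toT)`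

Cell `pub-balaban`, rung (B)+1 sub-cell t4, lineage `b2b-balaban-t4-ne7-p1`, generation 69 (CRUX PROVER NE7 #1); memo
`t4/b2b-balaban-t4-ne7-p1-g69/HUNT-H13-ROUTE-PI-TRANSPOSED.md` §5–§6 (2).  File F36 (over F35 `NE7FlatAverageBridge` and row NE3 leaf-01 g7's
`NE3SmoothRightInverseFlat`: `cpushIter_flat`, `iterate_Tcoarse_eq'`, `iterate_Tcoarse_dPot`, `iterate_Qcoarse_apply`, `interp_corner`).
WHY.  Memo H13 §5: (APE)'s normal part wants an EXACTNESS-PRESERVING smooth lift with the (R7) curl letter; lit-balaban's `H_k` has it in kernel (gauge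
covariance `Fs_HkOp_eq_of_sub_eq`, LIN-ONE-STEP `norm_curl_HkOp_le_curl`, exponential decay), in THEIR torus dictionary.  F35 identified the T4 straight
average of a pull-back with `n·Q_k`; THIS FILE lifts that to the T4 linearised average proper (`cpushIter L j flat = (Tcoarse L)^[j+1] = (Qcoarse L)^[j+1] −
dPot ∘ framePot`, row NE3): the corrector `dPot (interp M univ (framePot L (j+1) A))` is pure gauge (curl-free at the flat background,
`NE3SmoothRightInverseCurl.curlAt_flat_dPot`), so every CURL letter of `H_k` is a curl letter of the T4 right inverse.
WHAT ([folklore]; 0 def, 0 sorry).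
§1 **`cpushIter_flat_of_linQ_exact`** — THE GENERIC CORRECTOR THEOREM (row NE3 proved it for `smoothLift` only): for ANY `A` with
   `linQ (L^{j+1}) A ((L^{j+1})•z) κ = φ z κ` (all `z, κ`), `cpushIter L j flat (A + dPot (interp (L^{j+1}) univ (framePot L (j+1) A))) = φ`.
§2 entrywise bookkeeping: `linQ_apply_entry` (an entry of the straight average of a matrix field is the straight average of the entry field);
   `linQ_pullback_period` (the straight average of a pull-back at `M•z` depends on `toT M z` only).
§3 **`linQ_hkPull`** — for `B : Tor M × Fin d → Matrix n n ℂ` and the ENTRYWISE PULL-BACK `A_H(x,μ) i j := (HkOp (L^{j+1}) M *ᵥ B_{ij})(toT x, μ)`: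
   `linQ (L^{j+1}) A_H ((L^{j+1})•z) κ = (L^{j+1} : ℂ) • B (toT M z, κ)` for EVERY `z : Site d` (F35 §4 + periodicity).
§4 **`cpushIter_flat_hkPull`** — THE END: `cpushIter L j flat (A_H + corrector) = fun z κ => (L^{j+1} : ℂ) • B (toT M z, κ)`.
HONEST FRAMING (page 1): flat lattice kinematics + index bookkeeping; the LETTERS of `H_k` are not transferred here (that is brick 3: curl ↔ `Fs`,
sup ↔ `torusSupNorm`); nothing of Bałaban's asserted; NOT (APE), NOT ONE-STEP, NOT NE7; spine 0∕9; finite T⁴ rung (B)+1 — NOT infinite volume, NOT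
mass gap, NOT Clay.  Continuum YM on T⁴ ⇐ BetaPertH ∧ nine spine estimates (0/9 proved); BetaPertH ⇐ (D1) ∧ (D4) ∧ CAP+tail; G-an2-4 gates asym, D1 and NE2/3/4.
-/

set_option autoImplicit false

open scoped BigOperators Matrix Matrix.Norms.L2Operator
open Finset

namespace Summit.QuantumFields.BalabanUV.T4Continuum.NE7FlatHkRightInverse

open Literature.MathematicalPhysics.QuantumFieldTheory.Balaban1983to89
open B7Prop1Explicit (Site e boxVec)
open B7Prop3Flat (linQ)
open B7Prop4Flat (linQ_eq_sum)
open B5Prop11Plancherel (Tor fine)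
open B5Hk163Torus (HkOp)
open B6Lemma24Torus (IsPeriod)
open B6LowerBound2153Torus (toT rep toT_add toT_period isPeriod_rep_toT_sub)
open BlockAveragePushDirSplit (flat)
open SmoothRefineNeutral (Tcoarse)
open SmoothRefineInterp (interp)
open NE3TangentNoGoWords (dPot)
open NE3TangentFlatStructure (Qcoarse framePot iterate_Tcoarse_eq' linQ_shift)
open NE3FramePotGauge (iterate_Tcoarse_dPot)
open NE3CoarseInterpolant (interp_corner)
open ReplicationRightInverse (cpushIter)
open NE3SmoothRightInverseFlat (cpushIter_flat iterate_Tcoarse_add iterate_Qcoarse_apply)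
open NE7FlatAverageBridge (linQ_pullback_eq)
open B5Hk163Torus (QvOp_HkOp_mulVec)

noncomputable section

variable {d : ℕ} {n : Type*} [Fintype n] [DecidableEq n]

/-! ## §1 The generic corrector theorem -/

/-- **ANY LIFT EXACT FOR THE STRAIGHT `M`-BLOCK AVERAGE IS, AFTER THE CURL-FREE CORRECTOR, AN EXACT RIGHT INVERSE OF THE T4 LINEARISED
`(j+1)`-FOLD AVERAGE AT THE FLAT BACKGROUND** (`L ≥ 1`, `M = L^{j+1}`): if `linQ M A (M•z) κ = φ z κ` for all `z, κ`, then
`cpushIter L j flat (A + dPot (interp M univ (framePot L (j+1) A))) = φ` (row NE3's mechanism, lift-agnostic). [folklore] -/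
theorem cpushIter_flat_of_linQ_exact {L : ℕ} (hL : 1 ≤ L) (j : ℕ) (A φ : Site d → Fin d → Matrix n n ℂ)
    (hA : ∀ (z : Site d) (κ : Fin d), linQ (L ^ (j + 1)) A (((L ^ (j + 1) : ℕ) : ℤ) • z) κ = φ z κ) :
    cpushIter L j (flat (d := d) (n := n)) (A + dPot (interp (L ^ (j + 1)) Finset.univ (framePot L (j + 1) A))) = φ := by
  have hM1 : 1 ≤ L ^ (j + 1) := Nat.one_le_pow _ _ hL
  set G := framePot L (j + 1) A with hG
  rw [cpushIter_flat hL, iterate_Tcoarse_add, iterate_Tcoarse_eq' hL (j + 1) A, iterate_Tcoarse_dPot hL (j + 1)]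
  funext z κ
  simp only [Pi.add_apply]
  have hQ : (Qcoarse L)^[j + 1] A z κ = φ z κ := by rw [iterate_Qcoarse_apply, hA]
  have hcorner : (fun w => interp (L ^ (j + 1)) Finset.univ G (((L : ℤ) ^ (j + 1)) • w)) = G := by
    funext w
    have h := interp_corner hM1 Finset.univ G w
    rwa [show (((L ^ (j + 1) : ℕ) : ℤ)) = (L : ℤ) ^ (j + 1) by push_cast; ring] at h
  rw [hQ, hcorner, ← hG, sub_add_cancel]

/-! ## §2 Entrywise bookkeeping -/

/-- An entry of the straight average of a matrix-valued field is the straight average of the entry field. [folklore] -/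
theorem linQ_apply_entry (N : ℕ) (A : Site d → Fin d → Matrix n n ℂ) (q : Site d) (κ : Fin d) (i j : n) :
    linQ N A q κ i j = linQ N (fun x μ => A x μ i j) q κ := by
  rw [linQ_eq_sum, linQ_eq_sum]
  simp only [Matrix.sum_apply, Matrix.smul_apply]

/-- **THE STRAIGHT AVERAGE OF A PULL-BACK AT `M•z` DEPENDS ON `toT M z` ONLY**: for `Ã(x) = A(toT_{fine} x)`,
`linQ M Ã (M•z) κ = linQ M Ã (M•rep (toT M z)) κ` (the difference `M•(z − rep(toT z))` is a fine period). [folklore] -/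
theorem linQ_pullback_period (m : ℕ) (M : Fin d → ℕ) [∀ μ, NeZero (M μ)] (A : Tor (fine m M) × Fin d → ℂ) (z : Site d) (κ : Fin d) :
    linQ m (fun (x : Site d) (μ : Fin d) => A (toT (fine m M) x, μ)) ((m : ℤ) • z) κ
      = linQ m (fun (x : Site d) (μ : Fin d) => A (toT (fine m M) x, μ)) ((m : ℤ) • rep M (toT M z)) κ := by
  -- the shift vector `v := m•(z − rep(toT z))` is a period of the fine torus
  set v : Site d := (m : ℤ) • (z - rep M (toT M z)) with hv
  have hvP : IsPeriod (fine m M) v := by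
    intro i
    have h := isPeriod_rep_toT_sub M z i
    simp only [hv, Pi.smul_apply, Pi.sub_apply, smul_eq_mul, fine]
    obtain ⟨c, hc⟩ := h
    have hc' : rep M (toT M z) i - z i = (M i : ℤ) * c := hc
    refine ⟨-c, ?_⟩
    have : z i - rep M (toT M z) i = -((M i : ℤ) * c) := by rw [← hc']; ring
    rw [this]; push_cast; ring
  have hshift : (fun (x : Site d) (μ : Fin d) => A (toT (fine m M) (x + v), μ))
      = fun (x : Site d) (μ : Fin d) => A (toT (fine m M) x, μ) := by
    funext x μ
    rw [toT_add, toT_period (fine m M) hvP, add_zero]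
  have h := linQ_shift m (fun (x : Site d) (μ : Fin d) => A (toT (fine m M) x, μ)) v ((m : ℤ) • rep M (toT M z)) κ
  rw [hshift] at h
  rw [h]
  congr 1
  rw [hv, ← smul_add, add_sub_cancel]

/-! ## §3 The entrywise pull-back of `H_k` is exact for the straight average at every corner -/

/-- **`linQ M A_H (M•z) κ = M • B(toT M z, κ)` FOR EVERY `z : ℤ^d`** (`M = L^{j+1}`), where `A_H` is the entrywise pull-back of lit-balaban's
`H_k` applied to the entries of `B` (F35 `linQIter_pullback_HkOp` at the box representative + §2). [folklore] -/
theorem linQ_hkPull (L j : ℕ) [NeZero (L ^ (j + 1))] (M : Fin d → ℕ) [∀ μ, NeZero (M μ)] (B : Tor M × Fin d → Matrix n n ℂ)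
    (z : Site d) (κ : Fin d) :
    linQ (L ^ (j + 1))
        (fun (x : Site d) (μ : Fin d) => Matrix.of fun i i' : n =>
          (HkOp (L ^ (j + 1)) M *ᵥ fun p : Tor M × Fin d => B p i i') (toT (fine (L ^ (j + 1)) M) x, μ))
        (((L ^ (j + 1) : ℕ) : ℤ) • z) κ
      = ((L ^ (j + 1) : ℕ) : ℂ) • B (toT M z, κ) := by
  ext i i'
  rw [linQ_apply_entry, Matrix.smul_apply, smul_eq_mul]
  simp only [Matrix.of_apply]
  rw [linQ_pullback_period]
  rw [linQ_pullback_eq, QvOp_HkOp_mulVec]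

/-! ## §4 THE END: `H_k` pulled back + the corrector is an exact right inverse of the T4 linearised average at the flat background -/

/-- **`cpushIter L j flat (A_H + dPot (interp M univ (framePot L (j+1) A_H))) = M • (B ∘ toT)`** (`L ≥ 1`, `M = L^{j+1}`; `A_H` the entrywise
pull-back of `H_kB`): lit-balaban's Landau minimiser, read on ℤ^d and corrected by row NE3's curl-free pure-gauge term, is an EXACT right inverse of the
T4 linearised `(j+1)`-fold average at `U = 1`, up to the factor `M` of the two dictionaries' normalisations (F35). [folklore] -/
theorem cpushIter_flat_hkPull {L : ℕ} (hL : 1 ≤ L) (j : ℕ) (M : Fin d → ℕ) [∀ μ, NeZero (M μ)] (B : Tor M × Fin d → Matrix n n ℂ) :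
    haveI : NeZero (L ^ (j + 1)) := ⟨pow_ne_zero _ (by omega)⟩
    cpushIter L j (flat (d := d) (n := n))
        ((fun (x : Site d) (μ : Fin d) => Matrix.of fun i i' : n =>
            (HkOp (L ^ (j + 1)) M *ᵥ fun p : Tor M × Fin d => B p i i') (toT (fine (L ^ (j + 1)) M) x, μ))
          + dPot (interp (L ^ (j + 1)) Finset.univ (framePot L (j + 1)
              (fun (x : Site d) (μ : Fin d) => Matrix.of fun i i' : n =>
                (HkOp (L ^ (j + 1)) M *ᵥ fun p : Tor M × Fin d => B p i i') (toT (fine (L ^ (j + 1)) M) x, μ)))))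
      = fun (z : Site d) (κ : Fin d) => ((L ^ (j + 1) : ℕ) : ℂ) • B (toT M z, κ) := by
  haveI : NeZero (L ^ (j + 1)) := ⟨pow_ne_zero _ (by omega)⟩
  exact cpushIter_flat_of_linQ_exact hL j _ _ (fun z κ => linQ_hkPull L j M B z κ)

end

end Summit.QuantumFields.BalabanUV.T4Continuum.NE7FlatHkRightInverse
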